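import Summits.KontsevichZagierPeriods.KontsevichZagierPeriods.Theorems.SoloBlindTetraPrep
import HarnessLib

/-!
# The tetrahedral descent of `B(1/12,1/4)`, II: pull-backs, the second half, integrability

Continuation of `SoloBlindTetraPrep`. Here: the pull-back identities `H = (G ∘ μ)·|μ'|`,
`H₁ = (μ · G ∘ μ)·|μ'|`; the substitution `s = u²` on `(0,u₁)` and the
Möbius map `s = ν(x) = u₁²x/(1 + u₁²(1-x))`, `(0,1) → (0,u₁²)`, with the pull-back identities
`E(u) = L(u²)|2u|`, `L(s) = ½ s^{-1/2}((u₁²-s)(1+s))^{-3/4}`, and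
`L(ν(x))ν'(x) = (1/(4u₁)) x^{-1/2}(1-x)^{-3/4}` (using `1 + u₁² = 4u₁`); then the integrability
of all integrands of the chain — obtained from that of the Beta integrand `x^{-1/2}(1-x)^{-3/4}`
by transporting it BACKWARDS along the substitutions (one-variable change-of-variables
criterion). Semialgebraicity is in `SoloBlindTetraSemialg`, the moves in `SoloBlindTetra`.

References: M. Kontsevich, D. Zagier, *Periods* (2001), §1.2.
-/

noncomputable section

open Set MeasureTheory MvPolynomial

namespace Summit.KontsevichZagierPeriods.KontsevichZagierPeriods.Theorems

namespace SoloBlind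

open Literature.ModelTheory.ExponentialFields (IsSemialgebraic)
open Literature.NumberTheory.Transcendental
open Literature.NumberTheory.Transcendental.KZ

/-! ## The pull-back identities -/

/-- `((1-u)⁴)^{-3/4} = (1-u)^{-3}` for `u < 1`. -/
theorem tet_pow4 {u : ℝ} (hD : 0 < 1 - u) : ((1 - u) ^ 4) ^ (-(3 / 4 : ℝ)) = ((1 - u) ^ 3)⁻¹ := by
  rw [← Real.rpow_natCast (1 - u) 4, ← Real.rpow_mul hD.le, ← Real.rpow_natCast (1 - u) 3,
    ← Real.rpow_neg hD.le]
  norm_num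

/-- **Pull-back along `μ`:** `H(u) = G(μ(u)) |μ'(u)|` on `(-u₁,u₁)`. -/
theorem tet_pullback {u : ℝ} (hu : u ∈ Ioo (-tU) tU) :
    tetH u = tetG (tetMu u) * |tetMu' u| := by
  have hD : 0 < 1 - u := by linarith [hu.2, tU_lt_one]
  have hP := tetP_pos hu
  have hκ := tKappa_pos
  rw [tetG, tetMu_mul (by linarith [hu.2, tU_lt_one]), abs_of_pos (tetMu'_pos (by linarith)),
    tetMu', tetH, tetE, tC0, Real.div_rpow (by positivity) (by positivity),
    Real.mul_rpow hκ.le hP.le, tet_pow4 hD]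
  field_simp

/-- **Pull-back along `μ`, second value:** `H₁(u) = μ(u) G(μ(u)) |μ'(u)|` on `(-u₁,u₁)`. -/
theorem tet_pullback₁ {u : ℝ} (hu : u ∈ Ioo (-tU) tU) :
    tetH₁ u = tetMu u * tetG (tetMu u) * |tetMu' u| := by
  rw [mul_assoc, ← tet_pullback hu, tetH₁, tetH, tetMu, tet_num_eq]
  have hD : (1 - u) ≠ 0 := by
    have : u < 1 := hu.2.trans tU_lt_one
    exact sub_ne_zero.mpr (ne_of_gt this)
  field_simp


/-! ## The second half: `s = u²` and the Möbius map `ν` -/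

/-- `L(s) = ½ s^{-1/2} ((u₁²-s)(1+s))^{-3/4}`, the integrand after `s = u²`. -/
def tetL (s : ℝ) : ℝ := 1 / 2 * (s ^ (-(1 / 2 : ℝ)) * ((tU ^ 2 - s) * (1 + s)) ^ (-(3 / 4 : ℝ)))

/-- **Pull-back along `s = u²`:** `E(u) = L(u²)|2u|` on `(0,u₁)`. -/
theorem tet_sq {u : ℝ} (hu : u ∈ Ioo (0:ℝ) tU) : tetE u = tetL (u ^ 2) * |2 * u| := by
  have hu0 := hu.1
  have e : (u ^ 2) ^ (-(1 / 2 : ℝ)) = u⁻¹ := by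
    rw [← Real.rpow_natCast u 2, ← Real.rpow_mul hu0.le, ← Real.rpow_neg_one]
    norm_num
  rw [tetL, e, abs_of_pos (by positivity), tetE, tetP]
  field_simp

/-- The square map is injective on `(0,u₁)`. -/
theorem injOn_sq : InjOn (fun u : ℝ => u ^ 2) (Ioo (0:ℝ) tU) := fun x hx y hy h =>
  (pow_left_strictMonoOn₀ (by norm_num : (2:ℕ) ≠ 0)).injOn hx.1.le hy.1.le h

/-- The square map sends `(0,u₁)` onto `(0,u₁²)`. -/
theorem image_sq : Ioo (0:ℝ) (tU ^ 2) = (fun u : ℝ => u ^ 2) '' Ioo (0:ℝ) tU := by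
  ext s
  constructor
  · rintro ⟨h0, h1⟩
    refine ⟨Real.sqrt s, ⟨Real.sqrt_pos.mpr h0, ?_⟩, Real.sq_sqrt h0.le⟩
    calc Real.sqrt s < Real.sqrt (tU ^ 2) := Real.sqrt_lt_sqrt h0.le h1
      _ = tU := Real.sqrt_sq tU_pos.le
  · rintro ⟨u, ⟨h0, h1⟩, rfl⟩
    exact ⟨by positivity, pow_lt_pow_left₀ h1 h0.le (by norm_num)⟩

/-- The derivative of the square map. -/
theorem hasDerivAt_sq (u : ℝ) : HasDerivAt (fun u : ℝ => u ^ 2) (2 * u) u := by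
  simpa using hasDerivAt_pow 2 u

/-- The Möbius map `ν(x) = u₁² x/(1 + u₁²(1-x))` (`0 ↦ 0`, `1 ↦ u₁²`, `∞ ↦ -1`). -/
def tetNu (x : ℝ) : ℝ := tU ^ 2 * x / (1 + tU ^ 2 * (1 - x))

/-- `ν'(x) = u₁²(1+u₁²)/(1 + u₁²(1-x))²`. -/
def tetNu' (x : ℝ) : ℝ := tU ^ 2 * (1 + tU ^ 2) / (1 + tU ^ 2 * (1 - x)) ^ 2

/-- The denominator of `ν` is positive on `x < 1` (indeed for `x < 1 + u₁⁻²`). -/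
theorem tetNu_den_pos {x : ℝ} (hx : x < 1) : 0 < 1 + tU ^ 2 * (1 - x) := by
  have : 0 < tU ^ 2 * (1 - x) := mul_pos (pow_pos tU_pos 2) (by linarith)
  linarith

/-- `ν` is differentiable where its denominator does not vanish. -/
theorem hasDerivAt_tetNu {x : ℝ} (hx : 1 + tU ^ 2 * (1 - x) ≠ 0) :
    HasDerivAt tetNu (tetNu' x) x := by
  have h1 : HasDerivAt (fun y => tU ^ 2 * y) (tU ^ 2) x := by
    simpa using (hasDerivAt_id x).const_mul (tU ^ 2)
  have h2 : HasDerivAt (fun y => 1 + tU ^ 2 * (1 - y)) (-(tU ^ 2)) x := by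
    simpa using (((hasDerivAt_id x).const_sub 1).const_mul (tU ^ 2)).const_add 1
  refine (h1.div h2 hx).congr_deriv ?_
  unfold tetNu'
  field_simp
  ring

/-- `ν` is injective on `(0,1)`. -/
theorem injOn_tetNu : InjOn tetNu (Ioo (0:ℝ) 1) := by
  intro x hx y hy h
  have hDx := (tetNu_den_pos hx.2).ne'
  have hDy := (tetNu_den_pos hy.2).ne'
  unfold tetNu at h
  rw [div_eq_div_iff hDx hDy] at h
  have hc : 0 < tU ^ 2 * (1 + tU ^ 2) := by positivity [tU_pos]
  have h' : (x - y) * (tU ^ 2 * (1 + tU ^ 2)) = 0 := by linear_combination h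
  rcases mul_eq_zero.mp h' with h0 | h0
  · exact sub_eq_zero.mp h0
  · linarith

/-- `ν` maps `(0,1)` into `(0,u₁²)`. -/
theorem tetNu_mem {x : ℝ} (hx : x ∈ Ioo (0:ℝ) 1) : tetNu x ∈ Ioo (0:ℝ) (tU ^ 2) := by
  have hD := tetNu_den_pos hx.2
  have hc : 0 < tU ^ 2 := pow_pos tU_pos 2
  refine ⟨div_pos (mul_pos hc hx.1) hD, ?_⟩
  unfold tetNu
  rw [div_lt_iff₀ hD]
  have h1 : x < 1 + tU ^ 2 * (1 - x) := by
    have := mul_pos hc (show (0:ℝ) < 1 - x by linarith [hx.2])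
    linarith [hx.2]
  exact mul_lt_mul_of_pos_left h1 hc

/-- `ν` maps `(0,1)` ONTO `(0,u₁²)`: the inverse is `x = s(1+u₁²)/(u₁²(1+s))`. -/
theorem image_tetNu : Ioo (0:ℝ) (tU ^ 2) = tetNu '' Ioo (0:ℝ) 1 := by
  have hc : 0 < tU ^ 2 := pow_pos tU_pos 2
  have htU : tU ≠ 0 := tU_pos.ne'
  ext s
  constructor
  · rintro ⟨h0, h1⟩
    have hb : 0 < tU ^ 2 * (1 + s) := by positivity
    refine ⟨s * (1 + tU ^ 2) / (tU ^ 2 * (1 + s)), ⟨by positivity, ?_⟩, ?_⟩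
    · rw [div_lt_one hb]
      nlinarith
    · have hD : 1 + tU ^ 2 * (1 - s * (1 + tU ^ 2) / (tU ^ 2 * (1 + s))) ≠ 0 := by
        rw [show 1 + tU ^ 2 * (1 - s * (1 + tU ^ 2) / (tU ^ 2 * (1 + s)))
          = (1 + tU ^ 2) / (1 + s) by field_simp; ring]
        positivity
      unfold tetNu
      rw [div_eq_iff hD]
      field_simp
      ring
  · rintro ⟨x, hx, rfl⟩
    exact tetNu_mem hx

/-- `M(x) = (1/(4u₁)) x^{1/2-1}(1-x)^{1/4-1}`, the end of the chain. -/
def tetM (x : ℝ) : ℝ := (4 * tU)⁻¹ * betaFun (1 / 2) (1 / 4) x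

/-- **Pull-back along `ν`:** `M(x) = L(ν(x))|ν'(x)|` on `(0,1)` — the denominators
`1 + u₁²(1-x)` cancel (exponents `½ + 3/2 - 2 = 0`) and `1 + u₁² = 4u₁` evaluates the constant. -/
theorem tet_nu {x : ℝ} (hx : x ∈ Ioo (0:ℝ) 1) : tetM x = tetL (tetNu x) * |tetNu' x| := by
  obtain ⟨hx0, hx1⟩ := hx
  have hx1' : 0 < 1 - x := by linarith
  have hc : 0 < tU ^ 2 := pow_pos tU_pos 2
  have htU : tU ≠ 0 := tU_pos.ne'
  have htU0 : 0 < tU := tU_pos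
  have hD : 0 < 1 + tU ^ 2 * (1 - x) := by positivity
  have h1 : (tU ^ 2 - tetNu x) * (1 + tetNu x)
      = tU ^ 2 * (1 + tU ^ 2) ^ 2 * (1 - x) / (1 + tU ^ 2 * (1 - x)) ^ 2 := by
    unfold tetNu
    field_simp
    ring
  have c1 : (tU ^ 2) ^ (-(1 / 2 : ℝ)) = tU⁻¹ := by
    rw [← Real.rpow_natCast tU 2, ← Real.rpow_mul tU_pos.le, ← Real.rpow_neg_one]
    norm_num
  have c2 : (tU ^ 2 * (4 * tU) ^ 2) ^ (-(3 / 4 : ℝ)) = ((2 * tU) ^ 3)⁻¹ := by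
    rw [show tU ^ 2 * (4 * tU) ^ 2 = (2 * tU) ^ 4 by ring, ← Real.rpow_natCast (2 * tU) 4,
      ← Real.rpow_mul (by positivity), ← Real.rpow_natCast (2 * tU) 3,
      ← Real.rpow_neg (by positivity)]
    norm_num
  have d1 : (1 + tU ^ 2 * (1 - x)) ^ (-(1 / 2 : ℝ)) = ((1 + tU ^ 2 * (1 - x)) ^ (1 / 2 : ℝ))⁻¹ :=
    Real.rpow_neg hD.le _
  have d2 : ((1 + tU ^ 2 * (1 - x)) ^ 2) ^ (-(3 / 4 : ℝ))
      = ((1 + tU ^ 2 * (1 - x)) ^ (3 / 2 : ℝ))⁻¹ := by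
    rw [← Real.rpow_natCast _ 2, ← Real.rpow_mul hD.le, ← Real.rpow_neg hD.le]
    norm_num
  have d3 : (1 + tU ^ 2 * (1 - x)) ^ (1 / 2 : ℝ) * (1 + tU ^ 2 * (1 - x)) ^ (3 / 2 : ℝ)
      = (1 + tU ^ 2 * (1 - x)) ^ 2 := by
    rw [← Real.rpow_add hD, ← Real.rpow_natCast]
    norm_num
  have hD1 : (1 + tU ^ 2 * (1 - x)) ^ (1 / 2 : ℝ) ≠ 0 := (Real.rpow_pos_of_pos hD _).ne'
  have hD2 : (1 + tU ^ 2 * (1 - x)) ^ (3 / 2 : ℝ) ≠ 0 := (Real.rpow_pos_of_pos hD _).ne'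
  rw [tetL, h1, tetNu', abs_of_pos (by positivity), tetM, betaFun, one_add_tU_sq]
  unfold tetNu
  rw [Real.div_rpow (mul_nonneg hc.le hx0.le) hD.le, Real.mul_rpow hc.le hx0.le,
    Real.div_rpow (by positivity : (0:ℝ) ≤ tU ^ 2 * (4 * tU) ^ 2 * (1 - x)) (pow_nonneg hD.le 2),
    Real.mul_rpow (by positivity : (0:ℝ) ≤ tU ^ 2 * (4 * tU) ^ 2) hx1'.le,
    c1, c2, d1, d2, ← d3,
    show (((1 / 2 : ℚ) : ℝ) - 1) = -(1 / 2 : ℝ) by norm_num,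
    show (((1 / 4 : ℚ) : ℝ) - 1) = -(3 / 4 : ℝ) by norm_num]
  field_simp
  ring

/-! ## Integrability, transported backwards along the chain -/

/-- `M` is integrable on `(0,1)` (a multiple of the `B(1/2,1/4)` integrand). -/
theorem integrableOn_tetM : IntegrableOn tetM (Ioo 0 1) :=
  (integrableOn_betaFun (1 / 2) (1 / 4) (by norm_num) (by norm_num)).const_mul _

/-- `L` is integrable on `(0,u₁²)` (pull back `M` along `ν`). -/
theorem integrableOn_tetL : IntegrableOn tetL (Ioo 0 (tU ^ 2)) := by
  rw [image_tetNu, integrableOn_image_iff_integrableOn_abs_deriv_smul measurableSet_Ioo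
    (fun x hx => (hasDerivAt_tetNu (tetNu_den_pos hx.2).ne').hasDerivWithinAt) injOn_tetNu]
  exact integrableOn_tetM.congr_fun
    (fun x hx => by simp only [smul_eq_mul]; rw [mul_comm, ← tet_nu hx])
    measurableSet_Ioo

/-- `E` is integrable on `(0,u₁)` (pull back `L` along `u²`). -/
theorem integrableOn_tetE : IntegrableOn tetE (Ioo 0 tU) := by
  have h := integrableOn_tetL
  rw [image_sq, integrableOn_image_iff_integrableOn_abs_deriv_smul measurableSet_Ioo
    (fun u _ => (hasDerivAt_sq u).hasDerivWithinAt) injOn_sq] at h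
  exact h.congr_fun (fun u hu => by simp only [smul_eq_mul]; rw [mul_comm, ← tet_sq hu])
    measurableSet_Ioo

/-- A continuous multiple of `E` is integrable on `(0,u₁)`. -/
theorem integrableOn_mul_tetE {g : ℝ → ℝ} (hg : Continuous g) :
    IntegrableOn (fun u => g u * tetE u) (Ioo 0 tU) :=
  IntegrableOn.continuousOn_mul_of_subset hg.continuousOn integrableOn_tetE isCompact_Icc
    measurableSet_Ioo Ioo_subset_Icc_self

/-- `H⁻(u) = H(-u) = C₀(1+u)E(u)`. -/
def tetHn (u : ℝ) : ℝ := tC0 * ((1 + u) * tetE u)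

/-- `H₁⁻(u) = H₁(-u) = C₀(√3+1)/2 · (u₁-u)E(u)`. -/
def tetH₁n (u : ℝ) : ℝ := tC0 * ((r3 + 1) / 2 * ((tU - u) * tetE u))

/-- `H(-u) = H⁻(u)`. -/
theorem tetH_neg (u : ℝ) : tetH (-u) = tetHn u := by
  simp only [tetH, tetHn, tetE_neg, sub_neg_eq_add]

/-- `H₁(-u) = H₁⁻(u)`. -/
theorem tetH₁_neg (u : ℝ) : tetH₁ (-u) = tetH₁n u := by
  simp only [tetH₁, tetH₁n, tetE_neg, neg_add_eq_sub]

/-- `H` is integrable on `(0,u₁)`. -/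
theorem integrableOn_tetH_right : IntegrableOn tetH (Ioo 0 tU) :=
  (integrableOn_mul_tetE (g := fun u => tC0 * (1 - u)) (by fun_prop)).congr_fun
    (fun u _ => by simp only [tetH]; ring) measurableSet_Ioo

/-- `H⁻` is integrable on `(0,u₁)`. -/
theorem integrableOn_tetHn : IntegrableOn tetHn (Ioo 0 tU) :=
  (integrableOn_mul_tetE (g := fun u => tC0 * (1 + u)) (by fun_prop)).congr_fun
    (fun u _ => by simp only [tetHn]; ring) measurableSet_Ioo

/-- `H₁` is integrable on `(0,u₁)`. -/
theorem integrableOn_tetH₁_right : IntegrableOn tetH₁ (Ioo 0 tU) :=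
  (integrableOn_mul_tetE (g := fun u => tC0 * ((r3 + 1) / 2 * (u + tU))) (by fun_prop)).congr_fun
    (fun u _ => by simp only [tetH₁]; ring) measurableSet_Ioo

/-- `H₁⁻` is integrable on `(0,u₁)`. -/
theorem integrableOn_tetH₁n : IntegrableOn tetH₁n (Ioo 0 tU) :=
  (integrableOn_mul_tetE (g := fun u => tC0 * ((r3 + 1) / 2 * (tU - u))) (by fun_prop)).congr_fun
    (fun u _ => by simp only [tetH₁n]; ring) measurableSet_Ioo

/-- `2C₀ E` is integrable on `(0,u₁)`. -/
theorem integrableOn_two_tC0_tetE : IntegrableOn (fun u => 2 * tC0 * tetE u) (Ioo 0 tU) :=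
  integrableOn_mul_tetE (by fun_prop)

/-- `C₀(√3+1)u₁ E` is integrable on `(0,u₁)`. -/
theorem integrableOn_coeff_tetE : IntegrableOn (fun u => tC0 * (r3 + 1) * tU * tetE u) (Ioo 0 tU) :=
  integrableOn_mul_tetE (by fun_prop)

/-- `(-u₁,0)` is the reflection of `(0,u₁)`. -/
theorem tet_image_neg : Ioo (0:ℝ) tU = (fun u : ℝ => -u) '' Ioo (-tU) 0 := by
  rw [show (fun u : ℝ => -u) = Neg.neg from rfl, image_neg_Ioo, neg_zero, neg_neg]

/-- `H` is integrable on `(-u₁,0)` (reflect `H⁻`). -/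
theorem integrableOn_tetH_left : IntegrableOn tetH (Ioo (-tU) 0) := by
  have h := integrableOn_tetHn
  rw [tet_image_neg, integrableOn_image_iff_integrableOn_abs_deriv_smul measurableSet_Ioo
    (fun u _ => (hasDerivAt_neg u).hasDerivWithinAt) (fun x _ y _ h => neg_inj.mp h)] at h
  exact h.congr_fun (fun u _ => by simp [← tetH_neg]) measurableSet_Ioo

/-- `H₁` is integrable on `(-u₁,0)` (reflect `H₁⁻`). -/
theorem integrableOn_tetH₁_left : IntegrableOn tetH₁ (Ioo (-tU) 0) := by
  have h := integrableOn_tetH₁n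
  rw [tet_image_neg, integrableOn_image_iff_integrableOn_abs_deriv_smul measurableSet_Ioo
    (fun u _ => (hasDerivAt_neg u).hasDerivWithinAt) (fun x _ y _ h => neg_inj.mp h)] at h
  exact h.congr_fun (fun u _ => by simp [← tetH₁_neg]) measurableSet_Ioo

/-- `H` is integrable on `(-u₁,u₁)`. -/
theorem integrableOn_tetH : IntegrableOn tetH (Ioo (-tU) tU) := by
  rw [← Ioc_union_Ioo_eq_Ioo (neg_lt_zero.mpr tU_pos).le tU_pos]
  exact integrableOn_union.mpr
    ⟨(integrableOn_Ioc_iff_integrableOn_Ioo (f := tetH)).mpr integrableOn_tetH_left,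
      integrableOn_tetH_right⟩

/-- `H₁` is integrable on `(-u₁,u₁)`. -/
theorem integrableOn_tetH₁ : IntegrableOn tetH₁ (Ioo (-tU) tU) := by
  rw [← Ioc_union_Ioo_eq_Ioo (neg_lt_zero.mpr tU_pos).le tU_pos]
  exact integrableOn_union.mpr
    ⟨(integrableOn_Ioc_iff_integrableOn_Ioo (f := tetH₁)).mpr integrableOn_tetH₁_left,
      integrableOn_tetH₁_right⟩

/-- `G` is integrable on `(0,1)` (pull back `H` along `μ`). -/
theorem integrableOn_tetG : IntegrableOn tetG (Ioo 0 1) := by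
  rw [image_tetMu, integrableOn_image_iff_integrableOn_abs_deriv_smul measurableSet_Ioo
    (fun u hu => (hasDerivAt_tetMu (ne_of_lt (hu.2.trans tU_lt_one))).hasDerivWithinAt)
    injOn_tetMu]
  exact integrableOn_tetH.congr_fun
    (fun u hu => by simp only [smul_eq_mul]; rw [mul_comm, ← tet_pullback hu])
    measurableSet_Ioo

/-- `v G(v)` is integrable on `(0,1)` (pull back `H₁` along `μ`). -/
theorem integrableOn_tetG₁ : IntegrableOn (fun v => v * tetG v) (Ioo 0 1) := by
  rw [image_tetMu, integrableOn_image_iff_integrableOn_abs_deriv_smul measurableSet_Ioo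
    (fun u hu => (hasDerivAt_tetMu (ne_of_lt (hu.2.trans tU_lt_one))).hasDerivWithinAt)
    injOn_tetMu]
  exact integrableOn_tetH₁.congr_fun
    (fun u hu => by simp only [smul_eq_mul]; rw [mul_comm, ← tet_pullback₁ hu]) measurableSet_Ioo

end SoloBlind

end Summit.KontsevichZagierPeriods.KontsevichZagierPeriods.Theorems
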